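import Summits.ResolutionOfSingularities.ResolutionOfSingularities.Theorems.FrobeniusClosingPatchingRelPerfectTwoPlanesPlane
import Summits.ResolutionOfSingularities.ResolutionOfSingularities.Theorems.FrobeniusClosingPatchingRelPerfectTwoPlanesPlaneFacts
import Summits.ResolutionOfSingularities.ResolutionOfSingularities.Theorems.FrobeniusClosingPatchingRelPerfectTwoPlanesHyperplane
import HarnessLib

/-!
# Crux `PatchingRelPerfect` (stmt-ResolutionOfSingularities-16161), chain w52 — the rank-two member
# `f = x₀x₁ + x₂³`: the plane step on `B₂`, `B₃` modulo the five exceptional-curve facts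

[OURS · L1 W5.2 · rung, DESIGN STAGE → assembly] `…TwoPlanesPlane.isRegular_of_isBlowup_tpPlane` with
its chart-coordinate hypotheses discharged by `…TwoPlanesPlaneFacts` (stage models) and
`…TwoPlanesHyperplane` (strict transform of `V(x₁)`): on `B_i`, `i ≠ 0, 1`, every blowing up along the
image of `𝔪ᴺ · A · A₃ · A₄ · I` is regular PROVIDED the five polynomial facts about the exceptional
curves `(B_i/(u,e₀))[X] ⧸ (ē₁ + X ē₂³)` (domain, regular, `X ∉`) and `(B_i/(u,e₀))[S] ⧸ (S ē₁ + ē₂³)`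
(regular, `≠ 0`) hold — true on `B₂` (`ē₂ = 1`; next instance file), the last-but-one FALSE on `B₃`
(the `A₂` surface of the design note NEXT-two-planes-cube.md, which needs further centres).

* `isRegular_of_isBlowup_tpPlane₂₃`.

Nothing here is a statement of the manuscript under review.

## References

* The Stacks Project, Tags 080A, 080B, 0BIQ. [StacksProject]
-/

-- `Summit.<Summit>.<Sub>.Theorems` with `Sub = Summit` (single-conjunct summit, D-0017)
set_option linter.dupNamespace false

noncomputable section

open CategoryTheory CategoryTheory.Limits AlgebraicGeometry Literature.AlgebraicGeometry.Resolution
open IsLocalRing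

namespace Summit.ResolutionOfSingularities.ResolutionOfSingularities.Theorems

namespace TwoPlanesRung

open ConeRung

universe u

section PlaneTwoThree

variable {S : Type u} [CommRing S] [IsRegularLocalRing S] (x : Fin 4 → S)
  (hx : Ideal.span (Set.range x) = IsLocalRing.maximalIdeal S)
  (hd : (IsLocalRing.maximalIdeal S).spanFinrank = 4) (i : Fin 4)

local notation3 (prettyPrint := false) "M" => Ideal.span (Set.range x)
local notation3 (prettyPrint := false) "fT" => x 0 * x 1 + x 2 ^ 3
local notation3 (prettyPrint := false) "B" => chartRing x i
local notation3 (prettyPrint := false) "φ" => chartBase x i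
local notation3 (prettyPrint := false) "uB" => chartBase x i (x i)
local notation3 (prettyPrint := false) "e[" j "]" => chartGen x i j
/-- the strict transform `H♯ = e₀e₁ + u e₂³` of `f` -/
local notation3 (prettyPrint := false) "Hs" => chartGen x i 0 * chartGen x i 1 + chartBase x i (x i) * chartGen x i 2 ^ 3
local notation3 (prettyPrint := false) "U" => Ideal.span {chartBase x i (x i)}
/-- the plane centre `(u, e₀)` as a chart family and its ideal -/
local notation3 (prettyPrint := false) "cc" => (Fin.cons (chartBase x i (x i)) (fun _ : Fin 1 => chartGen x i 0) : Fin 2 → chartRing x i)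
local notation3 (prettyPrint := false) "II" => Ideal.span (Set.range
  (Fin.cons (chartBase x i (x i)) (fun _ : Fin 1 => chartGen x i 0) : Fin 2 → chartRing x i))
/-- the three later companion factors on `B_i` (divided by `u²` each) -/
local notation3 (prettyPrint := false) "J" => Ideal.span {chartGen x i 0 * chartGen x i 1, chartBase x i (x i)} *
    (Ideal.span {chartGen x i 0 * chartGen x i 1 + chartBase x i (x i) * chartGen x i 2 ^ 3} ⊔
      Ideal.span {chartBase x i (x i)} * Ideal.span {chartGen x i 0} ⊔ Ideal.span {chartBase x i (x i)} ^ 2) *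
    (Ideal.span {chartGen x i 0 * chartGen x i 1 + chartBase x i (x i) * chartGen x i 2 ^ 3} ⊔
      Ideal.span {chartBase x i (x i)} ^ 2)
/-- the exceptional-curve models of the two level-two charts -/
local notation3 (prettyPrint := false) "PP" => MvPolynomial {j : Fin 2 // j ≠ Fin.succ 0} (chartRing x i ⧸ II)
local notation3 (prettyPrint := false) "gFlat" => (MvPolynomial.C (Ideal.Quotient.mk II (chartGen x i 1)) :
    MvPolynomial {j : Fin 2 // j ≠ Fin.succ 0} (chartRing x i ⧸ II))
  + MvPolynomial.X (⟨0, (Fin.succ_ne_zero 0).symm⟩ : {j : Fin 2 // j ≠ Fin.succ 0}) *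
    MvPolynomial.C (Ideal.Quotient.mk II (chartGen x i 2 ^ 3))
local notation3 (prettyPrint := false) "XFlat" => (MvPolynomial.X (⟨0, (Fin.succ_ne_zero 0).symm⟩ : {j : Fin 2 // j ≠ Fin.succ 0}) :
  MvPolynomial {j : Fin 2 // j ≠ Fin.succ 0} (chartRing x i ⧸ II))
local notation3 (prettyPrint := false) "PP₀" => MvPolynomial {j : Fin 2 // j ≠ 0} (chartRing x i ⧸ II)
local notation3 (prettyPrint := false) "hFlat" => MvPolynomial.X (⟨1, one_ne_zero_fin2⟩ : {j : Fin 2 // j ≠ 0}) *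
    (MvPolynomial.C (Ideal.Quotient.mk II (chartGen x i 1)) : MvPolynomial {j : Fin 2 // j ≠ 0} (chartRing x i ⧸ II))
  + MvPolynomial.C (Ideal.Quotient.mk II (chartGen x i 2 ^ 3))


include hx hd in
/-- **The plane step on `B_i`, `i ≠ 0, 1`, modulo the five exceptional-curve facts.**
[cite: StacksProject, Tag 080A] [cite: StacksProject, Tag 080B] -/
theorem isRegular_of_isBlowup_tpPlane₂₃ (hi : i ≠ 0) (hi1 : i ≠ 1) (N : ℕ)
    (hPd : IsDomain (PP ⧸ Ideal.span {gFlat})) (hPr : IsRegularRing (PP ⧸ Ideal.span {gFlat}))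
    (hPX : XFlat ∉ Ideal.span {gFlat})
    (hQr : IsRegularRing (PP₀ ⧸ Ideal.span {hFlat})) (hQ0 : hFlat ≠ 0)
    {Y : Scheme.{u}} {ρ : Y ⟶ Spec (.of B)}
    (hρ : IsBlowup ρ (affineBlowup.idealSheaf
      ((M ^ N * (Ideal.span {fT} ⊔ Ideal.span {x 0} * M ⊔ M ^ 3) * (Ideal.span {fT} ⊔ M ^ 3) *
        (Ideal.span {fT} ⊔ Ideal.span {x 0} * M ^ 2 ⊔ M ^ 4) * (Ideal.span {fT} ⊔ M ^ 4)).map φ))) :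
    Scheme.IsRegular Y :=
  isRegular_of_isBlowup_tpPlane x hx hd i hi N (isDomain_quot_plane x hx hd i hi)
    (isDomain_quot_span_e1 x hx hd i hi1) (isDomain_quot_plane_sup_e1 x hx hd i hi hi1)
    (isDomain_quot_u_e1 x hx hd i hi1) (isRegularRing_quot_u_e1 x hx hd i hi1)
    (e1_notMem_plane x hx hd i hi hi1) (e0_notMem_span_e1 x hx hd i hi hi1)
    (e0_notMem_u_sup_e1 x hx hd i hi hi1) hPd hPr hPX hQr hQ0 hρ

end PlaneTwoThree

end TwoPlanesRung

end Summit.ResolutionOfSingularities.ResolutionOfSingularities.Theorems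

end
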